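import Summits.CriticalPhenomena.PercolationContinuityZ3.Theorems.FK.InfiniteVolumeMeasures
import Literature.Probability.Percolation.PositiveAssociationLimits
import HarnessLib

/-!
# FK-continuity transplant, FO-06 (construction half): positive association (FKG) of the free and
# wired infinite-volume random-cluster measures on `ℤ^d` (Grimmett 2006, Thm. (4.17)(b)/(4.19)(c))

Cell `fk-continuity` (bschramm), row FO-06 seat B; support file for the FK-continuity transplant
(`--supports stmt-CriticalPhenomena-4575`); builds on p205010 (kernel theorem, internal audit signed;
external expert review pending). No named facts, no sorries, standard axioms. General dimension `d`.

> **Theorem (4.17)(b)** (Grimmett 2006). Every `φ ∈ 𝒲_{p,q}` [the weak limits of finite-volume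
> random-cluster measures, `q ≥ 1`] is positively associated.

for the box limits `φ⁰_{p,q}`, `φ¹_{p,q}` on `ℤ^d` (`IsBoxLimit d b p q P`, `InfiniteVolumeDefs.lean`),
in the STRONG form of the tree's predicate `IsPositivelyAssociated P` (`PositiveAssociation.lean`):
`P(A) P(B) ≤ P(A ∩ B)` for ALL measurable increasing events `A, B` of the infinite configuration —
not only local ones (`IsBoxLimit.isPositivelyAssociated`). Proof as printed (Prop. (4.10)(b):
positive association survives weak limits; Thm. (3.8): the finite-volume FKG inequality, the tree's
`rcMeasure_fkg_holds`), executed with the tree's limit theorem for countable products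
`isPositivelyAssociated_pi_of_tendsto` (`PositiveAssociationLimits.lean`: Lindqvist 1988 Thm. 5.1 /
Grimmett (4.4)–(4.5), cylinder events suffice) after transporting configurations `Set (Sym2 ℤ^d)`
to spin functions `Sym2 ℤ^d → Bool` along the order isomorphism `boolFunEquivSet`
(`LocalLimitMeasure.lean`):

* `isPositivelyAssociated_rcMeasure`, `isPositivelyAssociated_rcBoxLaw` — the finite-volume
  measures and the box laws are positively associated (Thm. (3.8); monotone images,
  `IsPositivelyAssociated.map`);
* `IsBoxLimit.isPositivelyAssociated` — **`φ^b_{p,q}` is positively associated**, `0 ≤ p ≤ 1`,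
  `q ≥ 1`, `b ∈ {0,1}`, every `d`; with the real-valued two-event forms for increasing /
  decreasing / mixed pairs and finitely many increasing events (`IsBoxLimit.real_mul_le_inter`,
  `…_of_isLowerSet`, `IsBoxLimit.real_inter_le_mul`, `IsBoxLimit.prod_real_le_biInter`) and the
  versions for `rcLimit d b p q`.

## References

* G. Grimmett, *The Random-Cluster Model*, Springer 2006: §4.1 (4.4)–(4.10), Thm. (4.17)(b) and
  its proof (p. 76), Thm. (4.19)(c); Thm. (3.8). [Grimmett2006]
* C. M. Fortuin, P. W. Kasteleyn, J. Ginibre, Comm. Math. Phys. 22 (1971) 89–103.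
* B. H. Lindqvist, J. Appl. Probab. 25 (1988), Thm. 5.1 (via the tree's `PositiveAssociationLimits`).
-/

noncomputable section

open MeasureTheory Set Filter
open scoped Topology ENNReal

namespace Summit.CriticalPhenomena.PercolationContinuityZ3.Theorems.FK

open Literature.Probability.Percolation Literature.Probability.LatticeModels

variable {d : ℕ}

/-! ### Finite volume: the random-cluster measures and the box laws are positively associated -/

/-- **Grimmett 2006, Thm. (3.8) as a property of the measure**: for a finite graph, `0 ≤ p ≤ 1`,
`q ≥ 1` and any wired set, `φ^B_{G,p,q}` is positively associated (the tree's `rcMeasure_fkg_holds`).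
[cite: Grimmett2006, Thm. (3.8)] -/
theorem isPositivelyAssociated_rcMeasure {V : Type*} [Fintype V] [DecidableEq V] (G : SimpleGraph V)
    [DecidableRel G.Adj] {p q : ℝ} (hp : p ∈ Set.Icc (0 : ℝ) 1) (hq : 1 ≤ q) (B : Set V) :
    IsPositivelyAssociated (rcMeasure G p q B) := by
  haveI := isProbabilityMeasure_rcMeasure G hp (one_pos.trans_le hq) B
  exact isPositivelyAssociated_of_real fun _ _ hA hA' _ _ => rcMeasure_fkg_holds G hp hq B hA hA'

/-- **The box laws `φ^b_{Λ_n,p,q}` (read on `ℤ^d`) are positively associated** (`0 ≤ p ≤ 1`, `q ≥ 1`):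
a monotone measurable image (`liftEdges`) of a positively associated measure.
[cite: Grimmett2006, Thm. (3.8) and Thm. (4.17)(b)] -/
theorem isPositivelyAssociated_rcBoxLaw (b : Bool) {p q : ℝ} (hp : p ∈ Set.Icc (0 : ℝ) 1)
    (hq : 1 ≤ q) (n : ℕ) : IsPositivelyAssociated (rcBoxLaw d b p q n) :=
  (isPositivelyAssociated_rcMeasure _ hp hq _).map (liftEdges_mono (box d n))
    (measurable_liftEdges (box d n))

/-! ### Configurations as spin functions: the order isomorphism `boolFunEquivSet` -/

section Transport

variable {ι : Type*}

/-- `boolFunEquivSet : (ι → Bool) ≃ᵐ Set ι` is monotone (pointwise order `false < true` to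
inclusion). [folklore] -/
theorem monotone_boolFunEquivSet : Monotone (boolFunEquivSet ι) := by
  intro f g hfg i hi
  rw [mem_boolFunEquivSet_iff] at hi ⊢
  have h := hfg i
  rw [hi] at h
  exact top_le_iff.1 h

/-- Its inverse `Set ι → (ι → Bool)`, `ω ↦ (i ↦ [i ∈ ω])`, is monotone. [folklore] -/
theorem monotone_boolFunEquivSet_symm : Monotone (boolFunEquivSet ι).symm := by
  classical
  intro ω ω' h i
  simp only [boolFunEquivSet_symm_apply]
  rw [Bool.le_iff_imp, decide_eq_true_iff, decide_eq_true_iff]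
  exact fun hi => h hi

/-- A cylinder of the spin space pulls back, under `boolFunEquivSet⁻¹`, to the window event
`windowProj J ⁻¹' U` of configurations — a local event. [folklore] -/
theorem boolFunEquivSet_symm_preimage_restrict_preimage (J : Finset ι) (U : Set (J → Bool)) :
    (boolFunEquivSet ι).symm ⁻¹' ((fun f : ι → Bool => J.restrict f) ⁻¹' U) = windowProj J ⁻¹' U := by
  rw [windowProj_eq_restrict_comp, Set.preimage_comp]

/-- **Transport of positive association along `boolFunEquivSet`**: a measure on `Set ι` is positively
associated as soon as its image on the spin space `ι → Bool` is. [folklore] -/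
theorem isPositivelyAssociated_of_map_boolFunEquivSet_symm {μ : Measure (Set ι)}
    (h : IsPositivelyAssociated (μ.map (boolFunEquivSet ι).symm)) : IsPositivelyAssociated μ := by
  have hμ : μ = (μ.map (boolFunEquivSet ι).symm).map (boolFunEquivSet ι) := by
    rw [Measure.map_map (boolFunEquivSet ι).measurable (boolFunEquivSet ι).symm.measurable,
      MeasurableEquiv.self_comp_symm, Measure.map_id]
  rw [hμ]
  exact h.map monotone_boolFunEquivSet (boolFunEquivSet ι).measurable

/-- **Positive association passes to local limits on a configuration space** (Grimmett 2006,
Prop. (4.10)(b), in the tree's local-event form): if probability measures `μ_n` on `Set ι`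
(`ι` countable) are positively associated and converge to the probability measure `μ` on every
local event, then `μ` is positively associated — for ALL measurable increasing events.
[cite: Grimmett2006, Prop. (4.10)(b); Lindqvist1988, Thm. 5.1] -/
theorem isPositivelyAssociated_of_tendsto_isLocalEvent [Countable ι] (μs : ℕ → Measure (Set ι))
    (μ : Measure (Set ι)) [IsProbabilityMeasure μ] (hPA : ∀ n, IsPositivelyAssociated (μs n))
    (hconv : ∀ A : Set (Set ι), IsLocalEvent A → Tendsto (fun n => μs n A) atTop (𝓝 (μ A))) :
    IsPositivelyAssociated μ := by
  haveI : IsProbabilityMeasure (μ.map (boolFunEquivSet ι).symm) :=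
    Measure.isProbabilityMeasure_map (boolFunEquivSet ι).symm.measurable.aemeasurable
  refine isPositivelyAssociated_of_map_boolFunEquivSet_symm ?_
  refine isPositivelyAssociated_pi_of_tendsto (E := fun _ : ι => Bool) (l := atTop)
    (fun n => (μs n).map (boolFunEquivSet ι).symm) (μ.map (boolFunEquivSet ι).symm)
    (fun n => (hPA n).map monotone_boolFunEquivSet_symm (boolFunEquivSet ι).symm.measurable)
    fun J U hU => ?_
  have hmeas : MeasurableSet ((fun f : ι → Bool => J.restrict f) ⁻¹' U) :=
    hU.preimage (Finset.measurable_restrict J)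
  simp_rw [Measure.map_apply (boolFunEquivSet ι).symm.measurable hmeas,
    boolFunEquivSet_symm_preimage_restrict_preimage]
  exact hconv _ (isLocalEvent_preimage_windowProj J U)

end Transport

/-! ### Grimmett 2006, Thm. (4.17)(b): the box limits are positively associated -/

section Limit

variable {b : Bool} {p q : ℝ} {P : Measure (BondConfig (Site d))}

/-- **Grimmett 2006, Thm. (4.17)(b)/(4.19)(c) for the box limits on `ℤ^d`: `φ^b_{p,q}` is positively
associated** (`0 ≤ p ≤ 1`, `q ≥ 1`, either boundary condition, every `d`): `P(A) P(B) ≤ P(A ∩ B)`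
for all measurable increasing events `A, B` of the infinite bond configuration. Finite-volume FKG
(Thm. (3.8)) passed to the weak limit (Prop. (4.10)(b)). [cite: Grimmett2006, Thm. (4.17)(b) with Prop. (4.10)(b) and Thm. (3.8)] -/
theorem IsBoxLimit.isPositivelyAssociated (hP : IsBoxLimit d b p q P) (hp : p ∈ Set.Icc (0 : ℝ) 1)
    (hq : 1 ≤ q) : IsPositivelyAssociated P := by
  haveI := hP.isProbabilityMeasure
  exact isPositivelyAssociated_of_tendsto_isLocalEvent (rcBoxLaw d b p q) P
    (fun n => isPositivelyAssociated_rcBoxLaw b hp hq n) hP.tendsto_of_isLocalEvent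

/-- **`rcLimit d b p q` is positively associated** (`0 ≤ p ≤ 1`, `q ≥ 1`).
[cite: Grimmett2006, Thm. (4.17)(b)] -/
theorem isPositivelyAssociated_rcLimit (b : Bool) {p q : ℝ} (hp : p ∈ Set.Icc (0 : ℝ) 1)
    (hq : 1 ≤ q) : IsPositivelyAssociated (rcLimit d b p q) :=
  (isBoxLimit_rcLimit b hp hq).isPositivelyAssociated hp hq

/-- Real-valued form, two increasing events: `P(A) P(B) ≤ P(A ∩ B)`.
[cite: Grimmett2006, Thm. (4.17)(b)] -/
theorem IsBoxLimit.real_mul_le_inter (hP : IsBoxLimit d b p q P) (hp : p ∈ Set.Icc (0 : ℝ) 1)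
    (hq : 1 ≤ q) {A B : Set (BondConfig (Site d))} (hA : IsUpperSet A) (hB : IsUpperSet B)
    (hAm : MeasurableSet A) (hBm : MeasurableSet B) : P.real A * P.real B ≤ P.real (A ∩ B) := by
  haveI := hP.isProbabilityMeasure
  exact (hP.isPositivelyAssociated hp hq).real hA hB hAm hBm

/-- Two decreasing events: `P(A) P(B) ≤ P(A ∩ B)`. [cite: Grimmett2006, Thm. (4.17)(b)] -/
theorem IsBoxLimit.real_mul_le_inter_of_isLowerSet (hP : IsBoxLimit d b p q P)
    (hp : p ∈ Set.Icc (0 : ℝ) 1) (hq : 1 ≤ q) {A B : Set (BondConfig (Site d))} (hA : IsLowerSet A)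
    (hB : IsLowerSet B) (hAm : MeasurableSet A) (hBm : MeasurableSet B) :
    P.real A * P.real B ≤ P.real (A ∩ B) := by
  haveI := hP.isProbabilityMeasure
  have h := (hP.isPositivelyAssociated hp hq).lowerSet hA hB hAm hBm
  rw [measureReal_def, measureReal_def, measureReal_def, ← ENNReal.toReal_mul]
  exact ENNReal.toReal_mono (measure_ne_top P _) h

/-- One increasing and one decreasing event: `P(A ∩ B) ≤ P(A) P(B)`.
[cite: Grimmett2006, Thm. (4.17)(b)] -/
theorem IsBoxLimit.real_inter_le_mul (hP : IsBoxLimit d b p q P) (hp : p ∈ Set.Icc (0 : ℝ) 1)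
    (hq : 1 ≤ q) {A B : Set (BondConfig (Site d))} (hA : IsUpperSet A) (hB : IsLowerSet B)
    (hAm : MeasurableSet A) (hBm : MeasurableSet B) : P.real (A ∩ B) ≤ P.real A * P.real B := by
  haveI := hP.isProbabilityMeasure
  have h := (hP.isPositivelyAssociated hp hq).upperSet_lowerSet hA hB hAm hBm
  rw [measureReal_def, measureReal_def, measureReal_def, ← ENNReal.toReal_mul]
  exact ENNReal.toReal_mono (ENNReal.mul_ne_top (measure_ne_top P _) (measure_ne_top P _)) h

/-- Finitely many increasing events: `∏ᵢ P(Aᵢ) ≤ P(⋂ᵢ Aᵢ)`. [cite: Grimmett2006, Thm. (4.17)(b)] -/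
theorem IsBoxLimit.prod_real_le_biInter (hP : IsBoxLimit d b p q P) (hp : p ∈ Set.Icc (0 : ℝ) 1)
    (hq : 1 ≤ q) {κ : Type*} (s : Finset κ) {A : κ → Set (BondConfig (Site d))}
    (hA : ∀ i ∈ s, IsUpperSet (A i)) (hAm : ∀ i ∈ s, MeasurableSet (A i)) :
    ∏ i ∈ s, P.real (A i) ≤ P.real (⋂ i ∈ s, A i) := by
  haveI := hP.isProbabilityMeasure
  have h1 := (hP.isPositivelyAssociated hp hq).finset_prod_le_biInter s hA hAm
  have h2 : ∏ i ∈ s, P.real (A i) = (∏ i ∈ s, P (A i)).toReal := by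
    rw [ENNReal.toReal_prod]
    rfl
  rw [h2]
  exact ENNReal.toReal_mono (measure_ne_top P _) h1

end Limit

end Summit.CriticalPhenomena.PercolationContinuityZ3.Theorems.FK

end
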